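import Mathlib.Analysis.Calculus.MeanValue
import Mathlib.Analysis.SpecialFunctions.ExpDeriv
import Literature.Analysis.ODE.SoninEnvelope
import HarnessLib

/-!
# The free energy `|y′|² + σ²|y|²` along a half-line where `y″ + φy = 0` is a small perturbation of
# `y″ + σ²y = 0`: two-sided Grönwall bounds from the data at `−∞`

Topic `Literature/Analysis/ODE` (namespace `Literature.Analysis.ODE`). For a COMPLEX solution of
`y″ = −φ(x) y` (real `φ`) on a half-line `(−∞, b]` and a real `σ ≠ 0`, the energy of the FREE
equation `y″ + σ²y = 0`,

  `E(x) = |y′(x)|² + σ²|y(x)|²`,  `E′ = 2(σ² − φ)·Re(ȳ′ y)`,  `|E′| ≤ (|σ² − φ|/|σ|)·E`,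

is controlled by a MAJORANT `G` of the interaction: `G′ ≥ |σ² − φ|/|σ|`. Then `E·e^{−G}` is
non-increasing and `E·e^{G}` non-decreasing (`monotone_energy_mul_exp`), so if `E → E₀` and `G → G₀`
at `−∞`:

* `energy_le_of_majorant`, `le_energy_of_majorant` — `E₀e^{−(G(x) − G₀)} ≤ E(x) ≤ E₀e^{G(x) − G₀}`
  for every `x ≤ b`;
* `re_conj_mul_deriv_ge_of_flux_of_energy` — pointwise: a flux `Im(ȳ y′) = F ≠ 0` and an energy
  bound `|y′|² + σ²|y|² ≤ E` give `|y|² ≥ F²/E` and `Re(ȳ y′) ≥ −(E/|F|)·|y|²` (the solution cannot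
  be small, hence its logarithmic rate cannot be very negative).

This is the cap estimate of the threshold SLIVER of the near-extremal Kerr programme (crux
`KappaExplicitWaveDecay`): on the thin oscillatory cap before the barrier, `∫|φ − σ²|/|σ|` is small
uniformly in the surface gravity, so the horizon-normalised solution leaves the cap with
`Re(ū u′) ≥ −C|σ|·|u|²`. Elementary; all proved.

## References
* P. Hartman, *Ordinary Differential Equations* (SIAM Classics 38, 2002), Ch. XI §§2, 9 (a priori
  bounds by Grönwall for perturbations of `y″ + σ²y = 0`). Key `Hartman2002`.
-/

noncomputable section

open Set Filter Topology
open scoped ComplexConjugate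

namespace Literature.Analysis.ODE

section FreeEnergy

variable {y y' : ℝ → ℂ} {φ G G' : ℝ → ℝ} {σ b : ℝ}

/-- **Derivative of the free energy**: for `y″ = −φy`, `E = |y′|² + σ²|y|²` has
`E′ = 2(σ² − φ)Re(ȳ′ y)` and `|E′| ≤ 2|σ² − φ|·|y|·|y′|`. [cite: Hartman2002, Ch. XI §9] -/
theorem hasDerivAt_freeEnergy (hy : ∀ x ∈ Iic b, HasDerivAt y (y' x) x ∧
      HasDerivAt y' (-((φ x : ℂ) * y x)) x) {x : ℝ} (hx : x ∈ Iic b) :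
    HasDerivAt (fun s ↦ ‖y' s‖ ^ 2 + σ ^ 2 * ‖y s‖ ^ 2)
      (2 * (σ ^ 2 - φ x) * (conj (y' x) * y x).re) x ∧
    |2 * (σ ^ 2 - φ x) * (conj (y' x) * y x).re| ≤ 2 * |σ ^ 2 - φ x| * (‖y x‖ * ‖y' x‖) := by
  have h1 := hasDerivAt_norm_sq_complex (u := y') (u' := fun s ↦ -((φ s : ℂ) * y s)) (hy x hx).2
  have h2 := (hasDerivAt_norm_sq_complex (hy x hx).1).const_mul (σ ^ 2)
  constructor
  · refine (h1.add h2).congr_deriv ?_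
    have e1 : (conj (y' x) * -((φ x : ℂ) * y x)).re = -(φ x * (conj (y' x) * y x).re) := by
      rw [mul_neg, Complex.neg_re, ← mul_assoc, mul_comm (conj (y' x)) (φ x : ℂ), mul_assoc,
        Complex.re_ofReal_mul]
    have e2 : (conj (y x) * y' x).re = (conj (y' x) * y x).re := by
      rw [← Complex.conj_re (conj (y x) * y' x), map_mul, Complex.conj_conj, mul_comm]
    rw [e1, e2]; ring
  · rw [abs_mul, abs_mul, abs_of_pos (by norm_num : (0:ℝ) < 2)]
    refine mul_le_mul_of_nonneg_left ?_ (by positivity)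
    calc |(conj (y' x) * y x).re| ≤ ‖conj (y' x) * y x‖ := Complex.abs_re_le_norm _
      _ = ‖y x‖ * ‖y' x‖ := by rw [norm_mul, Complex.norm_conj, mul_comm]

/-- **Monotonicity of `E·e^{∓G}`.** If `G′ ≥ |σ² − φ|/|σ|` on `(−∞, b]` (`σ ≠ 0`), then
`E·e^{−G}` is non-increasing and `E·e^{G}` non-decreasing on `(−∞, b]`. [cite: Hartman2002, Ch. XI §9] -/
theorem monotone_energy_mul_exp (hy : ∀ x ∈ Iic b, HasDerivAt y (y' x) x ∧
      HasDerivAt y' (-((φ x : ℂ) * y x)) x) (hσ : σ ≠ 0)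
    (hG : ∀ x ∈ Iic b, HasDerivAt G (G' x) x) (hG' : ∀ x ∈ Iic b, |σ ^ 2 - φ x| / |σ| ≤ G' x) :
    AntitoneOn (fun s ↦ (‖y' s‖ ^ 2 + σ ^ 2 * ‖y s‖ ^ 2) * Real.exp (-G s)) (Iic b) ∧
    MonotoneOn (fun s ↦ (‖y' s‖ ^ 2 + σ ^ 2 * ‖y s‖ ^ 2) * Real.exp (G s)) (Iic b) := by
  have hσ0 : 0 < |σ| := abs_pos.2 hσ
  -- the key pointwise inequality `|E′| ≤ G′ E`
  have hkey : ∀ x ∈ Iic b, |2 * (σ ^ 2 - φ x) * (conj (y' x) * y x).re| ≤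
      G' x * (‖y' x‖ ^ 2 + σ ^ 2 * ‖y x‖ ^ 2) := by
    intro x hx
    have h1 := (hasDerivAt_freeEnergy (σ := σ) hy hx).2
    have h2 : 2 * (‖y x‖ * ‖y' x‖) ≤ (‖y' x‖ ^ 2 + σ ^ 2 * ‖y x‖ ^ 2) / |σ| := by
      rw [le_div_iff₀ hσ0]
      nlinarith [sq_nonneg (‖y' x‖ - |σ| * ‖y x‖), sq_abs σ, norm_nonneg (y x), norm_nonneg (y' x)]
    have h3 : 2 * |σ ^ 2 - φ x| * (‖y x‖ * ‖y' x‖) ≤ |σ ^ 2 - φ x| / |σ| * (‖y' x‖ ^ 2 + σ ^ 2 * ‖y x‖ ^ 2) := by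
      have := mul_le_mul_of_nonneg_left h2 (abs_nonneg (σ ^ 2 - φ x))
      calc 2 * |σ ^ 2 - φ x| * (‖y x‖ * ‖y' x‖) = |σ ^ 2 - φ x| * (2 * (‖y x‖ * ‖y' x‖)) := by ring
        _ ≤ |σ ^ 2 - φ x| * ((‖y' x‖ ^ 2 + σ ^ 2 * ‖y x‖ ^ 2) / |σ|) := this
        _ = |σ ^ 2 - φ x| / |σ| * (‖y' x‖ ^ 2 + σ ^ 2 * ‖y x‖ ^ 2) := by ring
    exact h1.trans (h3.trans (mul_le_mul_of_nonneg_right (hG' x hx) (by positivity)))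
  have hE : ∀ x ∈ Iic b, HasDerivAt (fun s ↦ ‖y' s‖ ^ 2 + σ ^ 2 * ‖y s‖ ^ 2)
      (2 * (σ ^ 2 - φ x) * (conj (y' x) * y x).re) x := fun x hx ↦ (hasDerivAt_freeEnergy hy hx).1
  constructor
  · have hF : ∀ x ∈ Iic b, HasDerivAt (fun s ↦ (‖y' s‖ ^ 2 + σ ^ 2 * ‖y s‖ ^ 2) * Real.exp (-G s))
        (2 * (σ ^ 2 - φ x) * (conj (y' x) * y x).re * Real.exp (-G x) +
          (‖y' x‖ ^ 2 + σ ^ 2 * ‖y x‖ ^ 2) * (Real.exp (-G x) * -G' x)) x :=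
      fun x hx ↦ (hE x hx).mul (hG x hx).neg.exp
    refine antitoneOn_of_deriv_nonpos (convex_Iic b)
      (fun x hx ↦ (hF x hx).continuousAt.continuousWithinAt)
      (fun x hx ↦ (hF x (interior_subset hx)).differentiableAt.differentiableWithinAt) ?_
    intro x hx
    have hx' : x ∈ Iic b := interior_subset hx
    rw [(hF x hx').deriv]
    have he : 0 < Real.exp (-G x) := Real.exp_pos _
    have h := (abs_le.1 (hkey x hx')).2
    nlinarith [h, he]
  · have hF : ∀ x ∈ Iic b, HasDerivAt (fun s ↦ (‖y' s‖ ^ 2 + σ ^ 2 * ‖y s‖ ^ 2) * Real.exp (G s))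
        (2 * (σ ^ 2 - φ x) * (conj (y' x) * y x).re * Real.exp (G x) +
          (‖y' x‖ ^ 2 + σ ^ 2 * ‖y x‖ ^ 2) * (Real.exp (G x) * G' x)) x :=
      fun x hx ↦ (hE x hx).mul (hG x hx).exp
    refine monotoneOn_of_deriv_nonneg (convex_Iic b)
      (fun x hx ↦ (hF x hx).continuousAt.continuousWithinAt)
      (fun x hx ↦ (hF x (interior_subset hx)).differentiableAt.differentiableWithinAt) ?_
    intro x hx
    have hx' : x ∈ Iic b := interior_subset hx
    rw [(hF x hx').deriv]
    have he : 0 < Real.exp (G x) := Real.exp_pos _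
    have h := (abs_le.1 (hkey x hx')).1
    nlinarith [h, he]

/-- **Upper Grönwall bound from `−∞`.** Under the hypotheses of `monotone_energy_mul_exp`, if
`E → E₀` and `G → G₀` at `−∞`, then `E(x) ≤ E₀·e^{G(x) − G₀}` for every `x ≤ b`. [cite: Hartman2002, Ch. XI §9] -/
theorem energy_le_of_majorant (hy : ∀ x ∈ Iic b, HasDerivAt y (y' x) x ∧
      HasDerivAt y' (-((φ x : ℂ) * y x)) x) (hσ : σ ≠ 0)
    (hG : ∀ x ∈ Iic b, HasDerivAt G (G' x) x) (hG' : ∀ x ∈ Iic b, |σ ^ 2 - φ x| / |σ| ≤ G' x)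
    {E₀ G₀ : ℝ} (hE₀ : Tendsto (fun s ↦ ‖y' s‖ ^ 2 + σ ^ 2 * ‖y s‖ ^ 2) atBot (𝓝 E₀))
    (hG₀ : Tendsto G atBot (𝓝 G₀)) {x : ℝ} (hx : x ≤ b) :
    ‖y' x‖ ^ 2 + σ ^ 2 * ‖y x‖ ^ 2 ≤ E₀ * Real.exp (G x - G₀) := by
  obtain ⟨hanti, -⟩ := monotone_energy_mul_exp hy hσ hG hG'
  -- `E(x)e^{−G(x)} ≤ E(t)e^{−G(t)}` for all `t ≤ x`, and the right side tends to `E₀e^{−G₀}`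
  have hlim : Tendsto (fun t ↦ (‖y' t‖ ^ 2 + σ ^ 2 * ‖y t‖ ^ 2) * Real.exp (-G t)) atBot
      (𝓝 (E₀ * Real.exp (-G₀))) := hE₀.mul (Real.continuous_exp.continuousAt.tendsto.comp hG₀.neg)
  have hle : (‖y' x‖ ^ 2 + σ ^ 2 * ‖y x‖ ^ 2) * Real.exp (-G x) ≤ E₀ * Real.exp (-G₀) := by
    refine ge_of_tendsto hlim ?_
    filter_upwards [eventually_le_atBot x] with t ht
    exact hanti (mem_Iic.2 (ht.trans hx)) (mem_Iic.2 hx) ht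
  have he : 0 < Real.exp (-G x) := Real.exp_pos _
  calc ‖y' x‖ ^ 2 + σ ^ 2 * ‖y x‖ ^ 2
      = (‖y' x‖ ^ 2 + σ ^ 2 * ‖y x‖ ^ 2) * Real.exp (-G x) * Real.exp (G x) := by
        rw [mul_assoc, ← Real.exp_add, neg_add_cancel, Real.exp_zero, mul_one]
    _ ≤ E₀ * Real.exp (-G₀) * Real.exp (G x) := mul_le_mul_of_nonneg_right hle (Real.exp_pos _).le
    _ = E₀ * Real.exp (G x - G₀) := by rw [mul_assoc, ← Real.exp_add]; ring_nf

/-- **Lower Grönwall bound from `−∞`**: `E₀·e^{−(G(x) − G₀)} ≤ E(x)` for every `x ≤ b`.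
[cite: Hartman2002, Ch. XI §9] -/
theorem le_energy_of_majorant (hy : ∀ x ∈ Iic b, HasDerivAt y (y' x) x ∧
      HasDerivAt y' (-((φ x : ℂ) * y x)) x) (hσ : σ ≠ 0)
    (hG : ∀ x ∈ Iic b, HasDerivAt G (G' x) x) (hG' : ∀ x ∈ Iic b, |σ ^ 2 - φ x| / |σ| ≤ G' x)
    {E₀ G₀ : ℝ} (hE₀ : Tendsto (fun s ↦ ‖y' s‖ ^ 2 + σ ^ 2 * ‖y s‖ ^ 2) atBot (𝓝 E₀))
    (hG₀ : Tendsto G atBot (𝓝 G₀)) {x : ℝ} (hx : x ≤ b) :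
    E₀ * Real.exp (-(G x - G₀)) ≤ ‖y' x‖ ^ 2 + σ ^ 2 * ‖y x‖ ^ 2 := by
  obtain ⟨-, hmono⟩ := monotone_energy_mul_exp hy hσ hG hG'
  have hlim : Tendsto (fun t ↦ (‖y' t‖ ^ 2 + σ ^ 2 * ‖y t‖ ^ 2) * Real.exp (G t)) atBot
      (𝓝 (E₀ * Real.exp G₀)) := hE₀.mul (Real.continuous_exp.continuousAt.tendsto.comp hG₀)
  have hle : E₀ * Real.exp G₀ ≤ (‖y' x‖ ^ 2 + σ ^ 2 * ‖y x‖ ^ 2) * Real.exp (G x) := by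
    refine le_of_tendsto hlim ?_
    filter_upwards [eventually_le_atBot x] with t ht
    exact hmono (mem_Iic.2 (ht.trans hx)) (mem_Iic.2 hx) ht
  have he : 0 < Real.exp (G x) := Real.exp_pos _
  calc E₀ * Real.exp (-(G x - G₀)) = E₀ * Real.exp G₀ * Real.exp (-G x) := by
        rw [mul_assoc, ← Real.exp_add]; ring_nf
    _ ≤ (‖y' x‖ ^ 2 + σ ^ 2 * ‖y x‖ ^ 2) * Real.exp (G x) * Real.exp (-G x) :=
        mul_le_mul_of_nonneg_right hle (Real.exp_pos _).le
    _ = ‖y' x‖ ^ 2 + σ ^ 2 * ‖y x‖ ^ 2 := by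
        rw [mul_assoc, ← Real.exp_add, add_neg_cancel, Real.exp_zero, mul_one]

/-! ### Pointwise consequence of a flux and an energy bound -/

/-- **A flux-carrying point with bounded free energy.** If `Im(ȳ y′) = F ≠ 0` and
`|y′|² + σ²|y|² ≤ E`, then `F² ≤ E·|y|²` (indeed `|F| ≤ |y||y′|`, `|y′| ≤ √E`) and
`Re(ȳ y′) ≥ −(E/|F|)·|y|²`. [folklore] -/
theorem re_conj_mul_deriv_ge_of_flux_of_energy {v v' : ℂ} {F E σ : ℝ} (hF : (conj v * v').im = F)
    (hF0 : F ≠ 0) (hE : ‖v'‖ ^ 2 + σ ^ 2 * ‖v‖ ^ 2 ≤ E) :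
    F ^ 2 ≤ E * ‖v‖ ^ 2 ∧ -(E / |F|) * ‖v‖ ^ 2 ≤ (conj v * v').re := by
  have hid : (conj v * v').re ^ 2 + (conj v * v').im ^ 2 = ‖v‖ ^ 2 * ‖v'‖ ^ 2 := by
    have h : ‖conj v * v'‖ ^ 2 = (conj v * v').re ^ 2 + (conj v * v').im ^ 2 := by
      rw [Complex.sq_norm, Complex.normSq_apply]; ring
    rw [← h, norm_mul, Complex.norm_conj, mul_pow]
  rw [hF] at hid
  have hF2 : 0 < F ^ 2 := by positivity
  have hv'2 : ‖v'‖ ^ 2 ≤ E := by nlinarith [sq_nonneg σ, norm_nonneg v]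
  -- `F² ≤ |v|²|v′|² ≤ |v|² E`
  have h1 : F ^ 2 ≤ E * ‖v‖ ^ 2 := by
    have : F ^ 2 ≤ ‖v‖ ^ 2 * ‖v'‖ ^ 2 := by nlinarith [sq_nonneg (conj v * v').re]
    nlinarith [this, hv'2, sq_nonneg ‖v‖]
  refine ⟨h1, ?_⟩
  have hFa : 0 < |F| := abs_pos.2 hF0
  have hE0 : 0 < E := by
    have : 0 < E * ‖v‖ ^ 2 := hF2.trans_le h1
    nlinarith [sq_nonneg ‖v‖]
  -- `|Re| ≤ |v||v′| = |v|²·(|v′|/|v|)` and `|v′|/|v| ≤ |v′|²/|F| ≤ E/|F|` since `|F| ≤ |v||v′|`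
  have hP : 0 ≤ ‖v‖ * ‖v'‖ := by positivity
  have hvv : |F| ≤ ‖v‖ * ‖v'‖ := by
    have : |F| ^ 2 ≤ (‖v‖ * ‖v'‖) ^ 2 := by
      rw [sq_abs, mul_pow]; nlinarith [sq_nonneg (conj v * v').re]
    exact (pow_le_pow_iff_left₀ (abs_nonneg F) hP two_ne_zero).1 this
  have hre : |(conj v * v').re| ≤ ‖v‖ * ‖v'‖ := by
    have : |(conj v * v').re| ^ 2 ≤ (‖v‖ * ‖v'‖) ^ 2 := by rw [sq_abs, mul_pow]; nlinarith
    exact (pow_le_pow_iff_left₀ (abs_nonneg _) hP two_ne_zero).1 this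
  -- `|v||v′| ≤ (E/|F|)|v|²`: multiply `|F| ≤ |v||v′|` by `|v′| ≤ ...`; cleaner: `|v||v′|·|F| ≤ |v|²|v′|² ≤ |v|² E`
  have h2 : ‖v‖ * ‖v'‖ ≤ E / |F| * ‖v‖ ^ 2 := by
    rw [div_mul_eq_mul_div, le_div_iff₀ hFa]
    calc ‖v‖ * ‖v'‖ * |F| ≤ ‖v‖ * ‖v'‖ * (‖v‖ * ‖v'‖) :=
          mul_le_mul_of_nonneg_left hvv (by positivity)
      _ = ‖v‖ ^ 2 * ‖v'‖ ^ 2 := by ring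
      _ ≤ ‖v‖ ^ 2 * E := mul_le_mul_of_nonneg_left hv'2 (sq_nonneg _)
      _ = E * ‖v‖ ^ 2 := by ring
  have := (abs_le.1 hre).1
  linarith

end FreeEnergy

end Literature.Analysis.ODE

end
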